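import Summits.FinalStateConjecture.FinalStateConjecture.Theorems.EIHFluxBalanceInertialRecessionVirialFamily

/-!
# Route EIHFluxBalance — crux `InertialRecession`, abstract endgame for general `N`:
# the frozen-block family is laminar and contains the singletons

Helper file for the crux `stmt-FinalStateConjecture-10166` (virial route; `InertialRecession_seat0_session8_note.md` §A).
Mathlib-only. The family of step `i` consists of the nonempty strict subsets `B` of the root `𝒦` that QUALIFY at some level
`ℓ ∈ [k₀, L)`: at the start `s = 2^{ℓ−k₀} (i / 2^{ℓ−k₀})` of the level-`ℓ` index block of `i` the set is `(D, g)`-controlled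
(internal distances `≤ D`, distances to all other bodies `≥ g`), `Λ`-gapped (`ΛD < g`), with a near outsider (`< 2g`) and
`g ∈ [2^ℓ, 2^{ℓ+3})`. This file proves, from the motion bound `‖ξₓ(t_{m′}) − ξₓ(t_m)‖ ≤ (m′ − m) h` and `2^{ℓ−k₀} h ≤ 2^ℓ/16`:

* `family_laminar` — the family of every step is laminar (`Λ ≥ 32`);
* `singleton_mem_family` — every singleton of `𝒦` belongs to the family of every step `i ≤ n`, provided all mutual distances at
  the steps `≤ n` lie in `[2^{k₀+1}, 2^L)` and `|𝒦| ≥ 2`.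
-/

noncomputable section

open Finset

namespace Summit.FinalStateConjecture.FinalStateConjecture.Theorems.SublinearIsFree.Virial

open Literature.Geometry.Lorentzian

variable {N : ℕ}

/-- Motion across part of an index block: from the block start `s = 2^d (i/2^d)` to any `i′` with `s ≤ i′ ≤ s + 2^d`, every body
moves by at most `2^d h`. [folklore] -/
theorem move_from_blockStart (ξ : Fin N → ℝ → E3) {h T : ℝ} (hh0 : 0 ≤ h)
    (hmove : ∀ x (m m' : ℕ), m ≤ m' → ‖ξ x (T + m' * h) - ξ x (T + m * h)‖ ≤ (m' - m) * h)
    (d i i' : ℕ) (h1 : 2 ^ d * (i / 2 ^ d) ≤ i') (h2 : i' ≤ 2 ^ d * (i / 2 ^ d) + 2 ^ d) :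
    ∀ x, ‖ξ x (T + i' * h) - ξ x (T + (2 ^ d * (i / 2 ^ d) : ℕ) * h)‖ ≤ (2 : ℝ) ^ d * h := by
  intro x
  refine (hmove x _ _ h1).trans ?_
  have : ((i' : ℕ) : ℝ) - ((2 ^ d * (i / 2 ^ d) : ℕ) : ℝ) ≤ (2 : ℝ) ^ d := by
    have h2' : (i' : ℝ) ≤ ((2 ^ d * (i / 2 ^ d) + 2 ^ d : ℕ) : ℝ) := by exact_mod_cast h2
    push_cast at h2' ⊢
    linarith
  exact mul_le_mul_of_nonneg_right this hh0

/-- **The family of a step is laminar.** See the module docstring. [folklore] -/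
theorem family_laminar (ξ : Fin N → ℝ → E3) (𝒦 : Finset (Fin N)) {Λ h T : ℝ} {k₀ L : ℕ}
    (F : ℕ → Finset (Finset (Fin N)))
    (hFdef : ∀ i B, B ∈ F i ↔ B ⊂ 𝒦 ∧ B.Nonempty ∧ ∃ ℓ : ℕ, k₀ ≤ ℓ ∧ ℓ < L ∧ ∃ D g : ℝ,
      (∀ x ∈ B, ∀ y ∈ B, ‖ξ x (T + (2 ^ (ℓ - k₀) * (i / 2 ^ (ℓ - k₀)) : ℕ) * h) -
        ξ y (T + (2 ^ (ℓ - k₀) * (i / 2 ^ (ℓ - k₀)) : ℕ) * h)‖ ≤ D) ∧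
      (∀ x ∈ B, ∀ z ∈ univ \ B, g ≤ ‖ξ x (T + (2 ^ (ℓ - k₀) * (i / 2 ^ (ℓ - k₀)) : ℕ) * h) -
        ξ z (T + (2 ^ (ℓ - k₀) * (i / 2 ^ (ℓ - k₀)) : ℕ) * h)‖) ∧
      (∃ x₀ ∈ B, ∃ z₀ ∈ univ \ B, ‖ξ x₀ (T + (2 ^ (ℓ - k₀) * (i / 2 ^ (ℓ - k₀)) : ℕ) * h) -
        ξ z₀ (T + (2 ^ (ℓ - k₀) * (i / 2 ^ (ℓ - k₀)) : ℕ) * h)‖ < 2 * g) ∧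
      Λ * D < g ∧ (2 : ℝ) ^ ℓ ≤ g ∧ g < (2 : ℝ) ^ (ℓ + 3))
    (hΛ : 32 ≤ Λ) (hh0 : 0 ≤ h) (hhk : ∀ ℓ, k₀ ≤ ℓ → (2 : ℝ) ^ (ℓ - k₀) * h ≤ (2 : ℝ) ^ ℓ / 16)
    (hmove : ∀ x (m m' : ℕ), m ≤ m' → ‖ξ x (T + m' * h) - ξ x (T + m * h)‖ ≤ (m' - m) * h) (i : ℕ) :
    ∀ A ∈ F i, ∀ B ∈ F i, (A ∩ B).Nonempty → A ⊆ B ∨ B ⊆ A := by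
  intro A hA B hB hmeet
  obtain ⟨-, -, ℓ₁, hk₁, -, D₁, g₁, hD₁, hg₁, -, hgap₁, hℓ₁, -⟩ := (hFdef i A).mp hA
  obtain ⟨-, -, ℓ₂, hk₂, -, D₂, g₂, hD₂, hg₂, -, hgap₂, hℓ₂, -⟩ := (hFdef i B).mp hB
  -- transport both to the configuration of step `i`
  have hμ₁ := move_from_blockStart ξ hh0 hmove (ℓ₁ - k₀) i i (blockStart_le _ _) (lt_blockStart_add _ _).le
  have hμ₂ := move_from_blockStart ξ hh0 hmove (ℓ₂ - k₀) i i (blockStart_le _ _) (lt_blockStart_add _ _).le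
  have hg₁0 : 0 ≤ g₁ := (pow_pos (by norm_num : (0 : ℝ) < 2) ℓ₁).le.trans hℓ₁
  have hg₂0 : 0 ≤ g₂ := (pow_pos (by norm_num : (0 : ℝ) < 2) ℓ₂).le.trans hℓ₂
  obtain ⟨hD₁', hg₁', h1₁⟩ := oneGapped_transport hμ₁ hΛ hD₁ hg₁ hgap₁ hg₁0 (by linarith [hhk ℓ₁ hk₁])
  obtain ⟨hD₂', hg₂', h1₂⟩ := oneGapped_transport hμ₂ hΛ hD₂ hg₂ hgap₂ hg₂0 (by linarith [hhk ℓ₂ hk₂])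
  exact gapped_laminar' (s := univ) (Λ := 1) le_rfl (Finset.subset_univ _) (Finset.subset_univ _) hD₁' hg₁' hD₂' hg₂' h1₁ h1₂
    hmeet

/-- **Singletons belong to every family.** See the module docstring. [folklore] -/
theorem singleton_mem_family (ξ : Fin N → ℝ → E3) (𝒦 : Finset (Fin N)) {Λ h T : ℝ} {k₀ L n : ℕ}
    (F : ℕ → Finset (Finset (Fin N)))
    (hFdef : ∀ i B, B ∈ F i ↔ B ⊂ 𝒦 ∧ B.Nonempty ∧ ∃ ℓ : ℕ, k₀ ≤ ℓ ∧ ℓ < L ∧ ∃ D g : ℝ,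
      (∀ x ∈ B, ∀ y ∈ B, ‖ξ x (T + (2 ^ (ℓ - k₀) * (i / 2 ^ (ℓ - k₀)) : ℕ) * h) -
        ξ y (T + (2 ^ (ℓ - k₀) * (i / 2 ^ (ℓ - k₀)) : ℕ) * h)‖ ≤ D) ∧
      (∀ x ∈ B, ∀ z ∈ univ \ B, g ≤ ‖ξ x (T + (2 ^ (ℓ - k₀) * (i / 2 ^ (ℓ - k₀)) : ℕ) * h) -
        ξ z (T + (2 ^ (ℓ - k₀) * (i / 2 ^ (ℓ - k₀)) : ℕ) * h)‖) ∧
      (∃ x₀ ∈ B, ∃ z₀ ∈ univ \ B, ‖ξ x₀ (T + (2 ^ (ℓ - k₀) * (i / 2 ^ (ℓ - k₀)) : ℕ) * h) -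
        ξ z₀ (T + (2 ^ (ℓ - k₀) * (i / 2 ^ (ℓ - k₀)) : ℕ) * h)‖ < 2 * g) ∧
      Λ * D < g ∧ (2 : ℝ) ^ ℓ ≤ g ∧ g < (2 : ℝ) ^ (ℓ + 3))
    (hh0 : 0 ≤ h) (hhk : ∀ ℓ, k₀ ≤ ℓ → (2 : ℝ) ^ (ℓ - k₀) * h ≤ (2 : ℝ) ^ ℓ / 16)
    (hmove : ∀ x (m m' : ℕ), m ≤ m' → ‖ξ x (T + m' * h) - ξ x (T + m * h)‖ ≤ (m' - m) * h)
    (h𝒦 : 2 ≤ 𝒦.card)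
    (hrmin : ∀ i ≤ n, ∀ x y : Fin N, x ≠ y → (2 : ℝ) ^ (k₀ + 1) ≤ ‖ξ x (T + i * h) - ξ y (T + i * h)‖)
    (hL : ∀ i ≤ n, ∀ x y : Fin N, ‖ξ x (T + i * h) - ξ y (T + i * h)‖ < (2 : ℝ) ^ L)
    {i : ℕ} (hi : i ≤ n) {j : Fin N} (hj : j ∈ 𝒦) : ({j} : Finset (Fin N)) ∈ F i := by
  rw [hFdef]
  -- another body exists
  obtain ⟨j', hj', hjj'⟩ : ∃ j' ∈ 𝒦, j' ≠ j := by
    by_contra hno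
    push Not at hno
    have : 𝒦 ⊆ {j} := fun x hx ↦ Finset.mem_singleton.mpr (hno x hx)
    have := Finset.card_le_card this
    rw [Finset.card_singleton] at this
    omega
  refine ⟨Finset.ssubset_iff_subset_ne.mpr ⟨Finset.singleton_subset_iff.mpr hj, fun heq ↦ hjj' ?_⟩,
    Finset.singleton_nonempty j, ?_⟩
  · have : j' ∈ ({j} : Finset (Fin N)) := heq ▸ hj'
    exact Finset.mem_singleton.mp this
  -- nearest body at step `i`, its level
  have hne : (univ.erase j).Nonempty := ⟨j', Finset.mem_erase.mpr ⟨hjj', Finset.mem_univ _⟩⟩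
  obtain ⟨z₀, hz₀, hmin⟩ := exists_nearest (fun x ↦ ξ x (T + i * h)) j hne
  set d : ℝ := ‖ξ j (T + i * h) - ξ z₀ (T + i * h)‖ with hd
  have hz₀j : z₀ ≠ j := (Finset.mem_erase.mp hz₀).1
  have hdlo : (2 : ℝ) ^ (k₀ + 1) ≤ d := hrmin i hi j z₀ hz₀j.symm
  have hd2 : 2 ≤ d := le_trans (by
    calc (2 : ℝ) = 2 ^ (0 + 1) := by norm_num
      _ ≤ 2 ^ (k₀ + 1) := pow_le_pow_right₀ (by norm_num) (by omega)) hdlo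
  obtain ⟨ℓ, hℓ1, hℓ2⟩ := exists_level_of_two_le hd2
  have hk₀ℓ : k₀ ≤ ℓ := by
    by_contra hlt
    push Not at hlt
    have : (2 : ℝ) ^ (ℓ + 2) ≤ 2 ^ (k₀ + 1) := pow_le_pow_right₀ (by norm_num) (by omega)
    linarith
  have hℓL : ℓ < L := by
    by_contra hle
    push Not at hle
    have h1 : (2 : ℝ) ^ L ≤ 2 ^ (ℓ + 1) := pow_le_pow_right₀ (by norm_num) (by omega)
    have h2 := hL i hi j z₀
    linarith
  refine ⟨ℓ, hk₀ℓ, hℓL, ?_⟩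
  -- transport to the block start (earlier configuration)
  set s : ℕ := 2 ^ (ℓ - k₀) * (i / 2 ^ (ℓ - k₀)) with hs
  have hμ : ∀ x, ‖ξ x (T + (s : ℕ) * h) - ξ x (T + i * h)‖ ≤ (2 : ℝ) ^ (ℓ - k₀) * h := fun x ↦ by
    rw [norm_sub_rev]
    exact move_from_blockStart ξ hh0 hmove (ℓ - k₀) i i (blockStart_le _ _) (lt_blockStart_add _ _).le x
  set μ : ℝ := (2 : ℝ) ^ (ℓ - k₀) * h with hμdef
  have hμle : μ ≤ (2 : ℝ) ^ ℓ / 16 := hhk ℓ hk₀ℓ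
  have hμ0 : 0 ≤ μ := by positivity
  have h2ℓ : (2 : ℝ) ^ (ℓ + 1) = 2 ^ ℓ * 2 := by ring
  have h2ℓ' : (2 : ℝ) ^ (ℓ + 2) = 2 ^ ℓ * 4 := by ring
  have h2ℓ'' : (2 : ℝ) ^ (ℓ + 3) = 2 ^ ℓ * 8 := by ring
  have hpos2 : (0 : ℝ) < 2 ^ ℓ := pow_pos (by norm_num) ℓ
  -- control of `{j}` at the block start: `(0, d − 2μ)`
  obtain ⟨hD0, hext, hz₀out⟩ := singleton_controlled (fun x ↦ ξ x (T + i * h)) j hz₀ hmin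
  obtain ⟨_, hext'⟩ := controlled_transport (B := {j}) hμ hD0 hext
  refine ⟨0, d - 2 * μ, ?_, ?_, ⟨j, Finset.mem_singleton_self j, z₀, hz₀out, ?_⟩, ?_, ?_, ?_⟩
  · intro x hx y hy
    rw [Finset.mem_singleton] at hx hy
    subst hx; subst hy
    simp
  · simpa [hd] using hext'
  · have h := abs_dist_sub_dist_le_of_move hμ j z₀
    rw [abs_le] at h
    rw [hd] at hdlo hℓ1 ⊢
    nlinarith
  · rw [mul_zero]; nlinarith
  · nlinarith
  · nlinarith

/-- Registered one-line form of `family_laminar` (the frozen-block family of a step is laminar). [folklore] -/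
theorem family_laminar_of_blocks : open Literature.Geometry.Lorentzian Finset in ∀ {N : ℕ} (ξ : Fin N → ℝ → E3) (𝒦 : Finset (Fin N)) {Λ h T : ℝ} {k₀ L : ℕ} (F : ℕ → Finset (Finset (Fin N))), (∀ i B, B ∈ F i ↔ B ⊂ 𝒦 ∧ B.Nonempty ∧ ∃ ℓ : ℕ, k₀ ≤ ℓ ∧ ℓ < L ∧ ∃ D g : ℝ, (∀ x ∈ B, ∀ y ∈ B, ‖ξ x (T + (2 ^ (ℓ - k₀) * (i / 2 ^ (ℓ - k₀)) : ℕ) * h) - ξ y (T + (2 ^ (ℓ - k₀) * (i / 2 ^ (ℓ - k₀)) : ℕ) * h)‖ ≤ D) ∧ (∀ x ∈ B, ∀ z ∈ univ \ B, g ≤ ‖ξ x (T + (2 ^ (ℓ - k₀) * (i / 2 ^ (ℓ - k₀)) : ℕ) * h) - ξ z (T + (2 ^ (ℓ - k₀) * (i / 2 ^ (ℓ - k₀)) : ℕ) * h)‖) ∧ (∃ x₀ ∈ B, ∃ z₀ ∈ univ \ B, ‖ξ x₀ (T + (2 ^ (ℓ - k₀) * (i / 2 ^ (ℓ - k₀))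 : ℕ) * h) - ξ z₀ (T + (2 ^ (ℓ - k₀) * (i / 2 ^ (ℓ - k₀)) : ℕ) * h)‖ < 2 * g) ∧ Λ * D < g ∧ (2 : ℝ) ^ ℓ ≤ g ∧ g < (2 : ℝ) ^ (ℓ + 3)) → 32 ≤ Λ → 0 ≤ h → (∀ ℓ, k₀ ≤ ℓ → (2 : ℝ) ^ (ℓ - k₀) * h ≤ (2 : ℝ) ^ ℓ / 16) → (∀ x (m m' : ℕ), m ≤ m' → ‖ξ x (T + m' * h) - ξ x (T + m * h)‖ ≤ (m' - m) * h) → ∀ i : ℕ, ∀ A ∈ F i, ∀ B ∈ F i, (A ∩ B).Nonempty → A ⊆ B ∨ B ⊆ A :=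
  fun ξ 𝒦 _ _ _ _ _ F hFdef hΛ hh0 hhk hmove i ↦ family_laminar ξ 𝒦 F hFdef hΛ hh0 hhk hmove i

end Summit.FinalStateConjecture.FinalStateConjecture.Theorems.SublinearIsFree.Virial

end
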